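import Literature.Geometry.Riemannian.PerelmanEntropyFormulaIdentity
import HarnessLib

/-!
# The (pointed) Nash entropy of a conjugate heat flow along a Ricci flow
# (Bamler 2020a, §5.1: the functional `𝒩[g, f, τ]`, Def. 5.1, Prop. 5.2 and the display after it)

R. Bamler, *Entropy and heat kernel bounds on a Ricci flow background* (arXiv:2008.07093), §5.1,
recalls from Hein–Naber (2014) the **Nash entropy**: "If `(M, g)` is a Riemannian manifold,
`τ > 0` and `dν = (4πτ)^{-n/2} e^{-f} dg` is a probability measure on `M`, then we define
`𝒩[g, f, τ] = ∫_M f dν − n/2`, `𝒲[g, f, τ] = ∫_M (τ(|∇f|² + R) + f − n) dν`"; for a Ricci flow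
`(M, (g_t)_{t ∈ I})` on a compact manifold and a conjugate heat kernel measure
`dν_{x₀,t₀;t} = (4πτ)^{-n/2} e^{-f} dg = K(x₀, t₀; ·, t) dg`, `τ = t₀ − t`, the **pointed Nash
entropy** is `𝒩_{x₀,t₀}(τ) := 𝒩[g_{t₀−τ}, f_{t₀−τ}, τ]` (Def. 5.1), and Prop. 5.2 records
`d/dτ (τ 𝒩_{x₀,t₀}(τ)) = 𝒲[g_{t₀−τ}, f_{t₀−τ}, τ] ≤ 0`,
`d²/dτ² (τ 𝒩_{x₀,t₀}(τ)) = −2τ ∫ |Ric + ∇²f − g/2τ|² dν ≤ 0`, whence (display after Prop. 5.2)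
`𝒩_{x₀,t₀}(τ) ≥ (1/τ) ∫₀^τ μ[g_{t₀−τ'}, τ'] dτ'` ("so a lower bound on the pointed Nash entropy is
common in Ricci flows with non-degenerate initial data").

The computation behind these identities uses only that `K(x₀, t₀; ·, ·) dg` is a *conjugate heat
flow of probability densities*: `□* u = −∂ₜu − Δu + Ru = 0`, `u > 0`, `∫ u dg_t = 1`. Conjugate heat
KERNELS (fundamental solutions) of a Ricci flow are not in the tree, but conjugate heat flows from
smooth positive final data are (`IsConjugateHeatSolutionOn`, `ToppingEntropyIntegrand.lean`;
existence `IsRicciFlow.exists_isConjugateHeatSolutionOn_Icc`; conservation of `∫ u dV`,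
`ConjugateHeatConservation.lean`; Perelman's entropy formula `IsRicciFlow.hasDerivWithinAt_wEntropy`,
`PerelmanEntropyFormulaIdentity.lean`). This file vendors Bamler's §5.1 objects and PROVES the
identities of Prop. 5.2 and the entropy floor of the display after it in that generality, in the
forward time variable `t` of the tree's Ricci-flow layer (flow on `[0, T']`, basepoint time
`τ₀ > T'`, `τ = τ₀ − t`, so `d/dt = −d/dτ`):

* `PseudoRiemannianMetric.nashEntropy g f τ = 𝒩[g, f, τ] = ∫_M f u dV − n/2`,
  `u = (4πτ)^{-n/2} e^{-f}` (`entropyDensity`), `n = dim M` — Bamler's functional (§5.1);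
* `pointedNashEntropy g u n τ₀ t = ∫_M f(t) u(t) dV_{g(t)} − n/2`, `f = entropyPotential u n τ₀`
  (`u = (4π(τ₀ − t))^{-n/2} e^{-f}`) — the Nash entropy at time `t` of the conjugate heat flow `u`
  based at time `τ₀`; for `u = K(x₀, τ₀; ·, ·)` this is `𝒩_{x₀,τ₀}(τ₀ − t) = 𝒩*_t(x₀, τ₀)` of
  Def. 5.1 (`pointedNashEntropy_eq_nashEntropy`);
* `wEntropy_eq_nashEntropy_add` — `𝒲[g,f,τ] = τ ∫ (R + |∇f|²) dν + 𝒩[g,f,τ] − n/2` for compatible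
  `(g, f, τ)` (the relation between Perelman's `𝒲` of `PerelmanEntropy.lean` and `𝒩`);
* `muEntropy_le_wEntropy_of_integral_eq_one` — `μ[g, τ] ≤ 𝒲[g, f, τ]` for the potential `f` of a
  positive smooth probability density ("where the latter denotes Perelman's μ-functional");
* `IsRicciFlow.hasDerivWithinAt_pointedNashEntropy` —
  `d/dt 𝒩(t) = −∫ (R + |∇f|²) u dV_{g(t)} + n/(2(τ₀ − t))` (i.e. `d/dτ 𝒩 = ∫(|∇f|² + R)dν − n/2τ`);
* `IsRicciFlow.hasDerivWithinAt_mul_pointedNashEntropy` — **Prop. 5.2, first identity**: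
  `d/dt [(τ₀ − t) 𝒩(t)] = −𝒲(g(t), f(t), τ₀ − t)`;
* `IsRicciFlow.mul_pointedNashEntropy_sub_eq_integral` — its integrated form
  `(τ₀ − t₁)𝒩(t₁) − (τ₀ − t₂)𝒩(t₂) = ∫_{t₁}^{t₂} 𝒲(s) ds`;
* `IsRicciFlow.monotoneOn_wEntropy_entropyPotential` and
  `IsRicciFlow.mul_wEntropy_le_mul_pointedNashEntropy_sub`, `…_sub_le_mul_wEntropy` — **Prop. 5.2,
  second identity, integrated**: `𝒲` is non-decreasing in `t` (Perelman), so `τ𝒩(τ)` is concave: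
  `(t₂ − t₁)𝒲(t₁) ≤ (τ₀ − t₁)𝒩(t₁) − (τ₀ − t₂)𝒩(t₂) ≤ (t₂ − t₁)𝒲(t₂)`;
* `IsRicciFlow.mul_pointedNashEntropy_add_mul_le` — **the display after Prop. 5.2** (entropy
  floor): if `F ≤ μ(g(s), τ₀ − s)` for `s ∈ [t₁, t₂]`, then
  `(τ₀ − t₂)𝒩(t₂) + (t₂ − t₁)F ≤ (τ₀ − t₁)𝒩(t₁)`.

Everything is proved (Green's first identity `GreenIdentity.lean`, `d/dt ∫ v dV_{g(t)} =
∫ (∂ₜv − Rv) dV` of `PerelmanEntropyDerivative.lean`, Perelman's formula); there are no named facts.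
What is NOT here: conjugate heat kernels and hence `𝒩_{x₀,t₀}(0) = 0`, the continuity of
`𝒩_{x₀,t₀}` at `τ = 0` and the gradient/Laplacian estimates of Bamler's Thm. 5.9; the lower bound
`d/dτ 𝒩 ≥ −n/2τ + R_min` and the doubling estimate (5.7) are immediate from
`hasDerivWithinAt_pointedNashEntropy` but not spelled out.
-- TODO(general form): the same statements for the conjugate heat kernel `K(x₀,t₀;·,·)` of a
-- compact Ricci flow (Bamler 2020a Def. 5.1 verbatim), once fundamental solutions are in the tree.

## References

* R. H. Bamler, *Entropy and heat kernel bounds on a Ricci flow background*, arXiv:2008.07093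
  (2020), §5.1: the display defining `𝒩[g,f,τ]`, `𝒲[g,f,τ]`; Def. 5.1; Prop. 5.2; the display
  following Prop. 5.2. [Bamler2020Entropy]
* H.-J. Hein, A. Naber, *New logarithmic Sobolev inequalities and an ε-regularity theorem for the
  Ricci flow*, Comm. Pure Appl. Math. 67 (2014), 1543–1561 (the pointed Nash entropy).
* G. Perelman, *The entropy formula for the Ricci flow and its geometric applications*,
  arXiv:math/0211159 (2002), §3.1, (3.4). [Perelman2002]
-/

noncomputable section

open Set Module MeasureTheory Function Bundle Filter Manifold
open scoped Manifold ContDiff Topology ENNReal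

namespace Literature.Geometry.Riemannian

open Lorentzian Lorentzian.PseudoRiemannianMetric

universe v w

/-! ### Bamler's Nash entropy functional and the pointed Nash entropy of a density flow -/

section Potential

variable {M : Type*}

/-- The density of the potential of `u(t)` at scale `τ₀ − t` is `u(t)` again:
`(4π(τ₀ − t))^{-n/2} e^{-f(t)} = u(t)` for `f = entropyPotential u n τ₀`, `u(t) > 0`, `t < τ₀`
(`entropyDensity_neg_log`). [cite: Topping2006, §8.1, (8.1.1)] -/
theorem entropyDensity_entropyPotential {u : ℝ → M → ℝ} (n : ℕ) {τ₀ t : ℝ}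
    (hpos : ∀ x, 0 < u t x) (ht : t < τ₀) :
    entropyDensity n (entropyPotential u n τ₀ t) (τ₀ - t) = u t :=
  entropyDensity_neg_log n hpos (sub_pos.2 ht)

end Potential

section Functional

variable {E : Type*} [NormedAddCommGroup E] [NormedSpace ℝ E] [FiniteDimensional ℝ E]
  {H : Type*} [TopologicalSpace H] {I : ModelWithCorners ℝ E H} {M : Type*} [TopologicalSpace M]
  [ChartedSpace H M] [IsManifold I ∞ M] [T3Space M] [MeasurableSpace M] [BorelSpace M]

/-- **Bamler's Nash entropy functional** `𝒩[g, f, τ] = ∫_M f dν − n/2`,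
`dν = (4πτ)^{-n/2} e^{-f} dV_g` (Bamler 2020a, §5.1, first display; Hein–Naber 2014), for a metric
`g`, a potential `f : M → ℝ` and a scale `τ`, with `n = dim M = finrank ℝ E`, the density
`u = entropyDensity n f τ = (4πτ)^{-n/2} e^{-f}` and `dV_g = g.riemVolume` of the layer
(`PerelmanEntropy.lean`). A Bochner integral (junk `0` for a non-integrable integrand); the source
assumes `dν` is a probability measure, which is not built in (cf. `IsEntropyCompatible`).
[cite: Bamler2020Entropy, §5.1, first display] -/
def _root_.Literature.Geometry.Lorentzian.PseudoRiemannianMetric.nashEntropy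
    (g : PseudoRiemannianMetric I ∞ E (TangentSpace I : M → Type _)) (f : M → ℝ) (τ : ℝ) : ℝ :=
  ∫ x, f x * entropyDensity (finrank ℝ E) f τ x ∂g.riemVolume - (finrank ℝ E : ℝ) / 2

/-- Unfolding of `𝒩[g, f, τ]`. [cite: Bamler2020Entropy, §5.1, first display] -/
theorem _root_.Literature.Geometry.Lorentzian.PseudoRiemannianMetric.nashEntropy_def
    (g : PseudoRiemannianMetric I ∞ E (TangentSpace I : M → Type _)) (f : M → ℝ) (τ : ℝ) :
    g.nashEntropy f τ =
      ∫ x, f x * entropyDensity (finrank ℝ E) f τ x ∂g.riemVolume - (finrank ℝ E : ℝ) / 2 := rfl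

/-- **The pointed Nash entropy of a density flow.** For a family of metrics `g`, a space-time
density `u : ℝ → M → ℝ`, the dimension `n` and a basepoint time `τ₀`, the Nash entropy at time `t`:
`𝒩(t) = ∫_M f(t) u(t) dV_{g(t)} − n/2` with the potential `f = entropyPotential u n τ₀`,
`f(t) = −log u(t) − (n/2) log(4π(τ₀ − t))`, i.e. `u(t) = (4π(τ₀ − t))^{-n/2} e^{-f(t)}`
(`entropyDensity_entropyPotential`). When `u = K(x₀, τ₀; ·, ·)` is the conjugate heat kernel of
a Ricci flow based at `(x₀, τ₀)` this is Bamler's `𝒩_{x₀,τ₀}(τ₀ − t) = 𝒩*_t(x₀, τ₀)`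
(2020a, Def. 5.1: "`𝒩_{x₀,t₀}(τ) := 𝒩[g_{t₀−τ}, f_{t₀−τ}, τ]`", "`𝒩*_s(x₀,t₀) := 𝒩_{x₀,t₀}(t₀ − s)`");
the tree has conjugate heat flows from smooth final data (`IsConjugateHeatSolutionOn`) but not yet
kernels, and the definition makes sense for any density flow.
[cite: Bamler2020Entropy, §5.1, Def. 5.1] -/
def pointedNashEntropy (g : ℝ → PseudoRiemannianMetric I ∞ E (TangentSpace I : M → Type _))
    (u : ℝ → M → ℝ) (n : ℕ) (τ₀ t : ℝ) : ℝ :=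
  ∫ x, entropyPotential u n τ₀ t x * u t x ∂(g t).riemVolume - (n : ℝ) / 2

/-- Unfolding of the pointed Nash entropy. [cite: Bamler2020Entropy, §5.1, Def. 5.1] -/
theorem pointedNashEntropy_def (g : ℝ → PseudoRiemannianMetric I ∞ E (TangentSpace I : M → Type _))
    (u : ℝ → M → ℝ) (n : ℕ) (τ₀ t : ℝ) :
    pointedNashEntropy g u n τ₀ t =
      ∫ x, entropyPotential u n τ₀ t x * u t x ∂(g t).riemVolume - (n : ℝ) / 2 := rfl

/-- **`pointedNashEntropy` is Bamler's `𝒩[g_t, f_t, τ₀ − t]`** for a positive density and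
`t < τ₀` (Def. 5.1 with `dν = u(t) dV_{g(t)}`). [cite: Bamler2020Entropy, §5.1, Def. 5.1] -/
theorem pointedNashEntropy_eq_nashEntropy
    (g : ℝ → PseudoRiemannianMetric I ∞ E (TangentSpace I : M → Type _)) {u : ℝ → M → ℝ}
    {τ₀ t : ℝ} (hpos : ∀ x, 0 < u t x) (ht : t < τ₀) :
    pointedNashEntropy g u (finrank ℝ E) τ₀ t =
      (g t).nashEntropy (entropyPotential u (finrank ℝ E) τ₀ t) (τ₀ - t) := by
  rw [pointedNashEntropy_def, PseudoRiemannianMetric.nashEntropy_def,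
    entropyDensity_entropyPotential (finrank ℝ E) hpos ht]

end Functional

/-! ### Static identities on a closed manifold: Green, `∫ f Δu = ∫ u|∇f|²`, `𝒲` versus `𝒩`, `μ ≤ 𝒲` -/

section Static

variable {m : ℕ} {H : Type v} [TopologicalSpace H]
  {I : ModelWithCorners ℝ (EuclideanSpace ℝ (Fin m)) H} [I.Boundaryless]
  {M : Type w} [TopologicalSpace M] [ChartedSpace H M] [IsManifold I ∞ M]
  [T2Space M] [CompactSpace M] [MeasurableSpace M] [BorelSpace M]

/-- **Green's first identity in the vocabulary of the Ricci-flow layer**: on a closed Riemannian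
manifold modelled on `ℝ^m`, `∫_M u Δ_g f dV_g = −∫_M g⁻¹(du, df) dV_g` for `u ∈ C¹`, `f ∈ C²`
(`integral_mul_dalembertian_eq_neg_integral_innerDual` of `GreenIdentity.lean`, Lee 2018,
Problem 2-23 (a), transported along `g = ofRiemannian (g.toContMDiffRiemannianMetric hg)` as in
`integral_laplaceBeltrami_eq_zero`). [cite: Lee2018, Problem 2-23 (a)] -/
theorem integral_mul_laplaceBeltrami_eq_neg_integral_innerDual
    {g : PseudoRiemannianMetric I ∞ (EuclideanSpace ℝ (Fin m)) (TangentSpace I : M → Type _)}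
    (hg : g.IsRiemannian) {u f : M → ℝ} (hu : ContMDiff I 𝓘(ℝ, ℝ) 1 u)
    (hf : ContMDiff I 𝓘(ℝ, ℝ) 2 f) :
    ∫ p, u p * g.laplaceBeltrami f p ∂g.riemVolume =
      -∫ p, g.innerDual p (mvfderiv I u p).toLinearMap (mvfderiv I f p).toLinearMap
        ∂g.riemVolume := by
  haveI := (ofRiemannian (g.toContMDiffRiemannianMetric hg)).hasLeviCivita
  have h1 := integral_mul_dalembertian_eq_neg_integral_innerDual
    (g.toContMDiffRiemannianMetric hg) hu hf
  rw [riemVolume_eq hg]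
  exact h1

omit [I.Boundaryless] [IsManifold I ∞ M] [T2Space M] [CompactSpace M] [MeasurableSpace M]
  [BorelSpace M] in
/-- **`du = −u df` for `f = −log u − c`**, `u > 0` differentiable: the differential of a positive
density in terms of that of its potential (`d(−log u) = −du/u`). [folklore] -/
theorem mvfderiv_eq_neg_smul_mvfderiv_neg_log {u : M → ℝ} {p : M}
    (hu : MDifferentiableAt I 𝓘(ℝ, ℝ) u p) (hpos : ∀ x, 0 < u x) (c : ℝ) :
    mvfderiv I u p = (-(u p)) • mvfderiv I (fun y ↦ -Real.log (u y) - c) p := by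
  have hF : HasDerivAt (fun s : ℝ ↦ -Real.log s - c) (-(u p)⁻¹) (u p) := by
    simpa using ((Real.hasDerivAt_log (hpos p).ne').neg).sub_const c
  have hcomp : (fun y ↦ -Real.log (u y) - c) = (fun s : ℝ ↦ -Real.log s - c) ∘ u := rfl
  ext v
  have key := mvfderiv_real_comp_apply hF hu v
  rw [← hcomp] at key
  rw [FunLike.coe_smul, Pi.smul_apply, key, smul_eq_mul]
  field_simp [(hpos p).ne']

/-- **`∫_M f Δ_g u dV_g = ∫_M u |∇f|²_g dV_g` for `f = −log u − c`** (`u > 0` smooth) on a closed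
Riemannian manifold: Green's first identity `∫ f Δu = −∫ g⁻¹(df, du)` and `du = −u df`. This is
the integration by parts behind Bamler's and Perelman's entropy computations
(`∫ Δu dV = ∫ (Δf − |∇f|²) u dV`, Topping 2006, Rem. 8.2.7). [cite: Topping2006, §8.2, Rem. 8.2.7] -/
theorem integral_neg_log_mul_laplaceBeltrami_eq
    {g : PseudoRiemannianMetric I ∞ (EuclideanSpace ℝ (Fin m)) (TangentSpace I : M → Type _)}
    (hg : g.IsRiemannian) {u : M → ℝ} (hu : ContMDiff I 𝓘(ℝ, ℝ) ∞ u) (hpos : ∀ x, 0 < u x)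
    (c : ℝ) :
    ∫ p, (-Real.log (u p) - c) * g.laplaceBeltrami u p ∂g.riemVolume =
      ∫ p, u p * g.gradSq (fun y ↦ -Real.log (u y) - c) p ∂g.riemVolume := by
  have hfs : ContMDiff I 𝓘(ℝ, ℝ) ∞ (fun y ↦ -Real.log (u y) - c) := contMDiff_neg_log_sub hu hpos c
  have hf1 : ContMDiff I 𝓘(ℝ, ℝ) 1 (fun y ↦ -Real.log (u y) - c) := hfs.of_le (by norm_cast)
  have hu2 : ContMDiff I 𝓘(ℝ, ℝ) 2 u := hu.of_le (by norm_cast)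
  rw [integral_mul_laplaceBeltrami_eq_neg_integral_innerDual hg hf1 hu2, ← integral_neg]
  refine integral_congr_ae (Eventually.of_forall fun p ↦ ?_)
  beta_reduce
  have hud : MDifferentiableAt I 𝓘(ℝ, ℝ) u p := (hu p).mdifferentiableAt (by simp)
  rw [mvfderiv_eq_neg_smul_mvfderiv_neg_log hud hpos c, PseudoRiemannianMetric.gradSq,
    PseudoRiemannianMetric.innerDual, PseudoRiemannianMetric.innerDual,
    ContinuousLinearMap.toLinearMap_smul, map_smul, map_smul, smul_eq_mul]
  ring

/-- **`𝒲` versus `𝒩`** (Bamler 2020a, §5.1, from the two displayed definitions):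
for a metric `g` on a closed manifold modelled on `ℝ^m`, a connection `cov` with continuous
scalar curvature `R` (e.g. Levi-Civita), `f` smooth, `τ > 0` and `(g, f, τ)` compatible
(`∫ u dV = 1`, `u = (4πτ)^{-m/2} e^{-f}`):
`𝒲(g, f, τ) = τ ∫_M (R + |∇f|²) u dV + 𝒩[g, f, τ] − m/2` (both sides being
`∫ [τ(R + |∇f|²) + f − m] u dV` expanded with `∫ u dV = 1`).
[cite: Bamler2020Entropy, §5.1, first display] -/
theorem wEntropy_eq_nashEntropy_add
    (g : PseudoRiemannianMetric I ∞ (EuclideanSpace ℝ (Fin m)) (TangentSpace I : M → Type _))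
    (cov : CovariantDerivative I (EuclideanSpace ℝ (Fin m)) (TangentSpace I : M → Type _))
    (hRc : Continuous fun x ↦ g.scalarCurvatureWith cov x) {f : M → ℝ}
    (hf : ContMDiff I 𝓘(ℝ, ℝ) ∞ f) {τ : ℝ} (hc : g.IsEntropyCompatible f τ) :
    g.wEntropy cov f τ =
      τ * ∫ x, (g.scalarCurvatureWith cov x + g.gradSq f x) *
          entropyDensity (finrank ℝ (EuclideanSpace ℝ (Fin m))) f τ x ∂g.riemVolume +
        g.nashEntropy f τ - (finrank ℝ (EuclideanSpace ℝ (Fin m)) : ℝ) / 2 := by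
  haveI := g.hasLeviCivita
  set n := finrank ℝ (EuclideanSpace ℝ (Fin m)) with hn
  set u : M → ℝ := entropyDensity n f τ with hu
  have hf1 : ContMDiff I 𝓘(ℝ, ℝ) 1 f := hf.of_le (by norm_cast)
  have huc : Continuous u := (contMDiff_entropyDensity n hf τ).continuous
  have hfc : Continuous f := hf.continuous
  have hG : Continuous fun x ↦ g.gradSq f x := continuous_innerDual_mvfderiv g hf1 hf1
  have hi1 : Integrable (fun x ↦ (g.scalarCurvatureWith cov x + g.gradSq f x) * u x) g.riemVolume :=
    g.integrable_of_continuous ((hRc.add hG).mul huc)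
  have hi2 : Integrable (fun x ↦ f x * u x) g.riemVolume := g.integrable_of_continuous (hfc.mul huc)
  have hi3 : Integrable u g.riemVolume := g.integrable_of_continuous huc
  have hc1 : ∫ x, u x ∂g.riemVolume = 1 := hc
  have hsplit : (fun x ↦ (τ * (g.scalarCurvatureWith cov x + g.gradSq f x) + f x - n) * u x) =
      fun x ↦ τ * ((g.scalarCurvatureWith cov x + g.gradSq f x) * u x) + f x * u x - (n : ℝ) * u x := by
    funext x; ring
  have hi12 : Integrable (fun x ↦ τ * ((g.scalarCurvatureWith cov x + g.gradSq f x) * u x) +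
      f x * u x) g.riemVolume := (hi1.const_mul τ).add hi2
  have e1 : ∫ x, τ * ((g.scalarCurvatureWith cov x + g.gradSq f x) * u x) + f x * u x - (n : ℝ) * u x
      ∂g.riemVolume = (∫ x, τ * ((g.scalarCurvatureWith cov x + g.gradSq f x) * u x) + f x * u x
      ∂g.riemVolume) - ∫ x, (n : ℝ) * u x ∂g.riemVolume := integral_sub hi12 (hi3.const_mul _)
  have e2 : ∫ x, τ * ((g.scalarCurvatureWith cov x + g.gradSq f x) * u x) + f x * u x ∂g.riemVolume =
      (∫ x, τ * ((g.scalarCurvatureWith cov x + g.gradSq f x) * u x) ∂g.riemVolume) +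
        ∫ x, f x * u x ∂g.riemVolume := integral_add (hi1.const_mul τ) hi2
  rw [PseudoRiemannianMetric.wEntropy_def, PseudoRiemannianMetric.nashEntropy_def, ← hn, ← hu,
    hsplit, e1, e2, integral_const_mul, integral_const_mul, hc1]
  ring

omit [I.Boundaryless] in
/-- **`μ[g, τ] ≤ 𝒲[g, f, τ]` for the potential of a positive probability density** (Bamler 2020a,
display after Prop. 5.2: "`𝒩_{x₀,t₀}(τ) ≥ (1/τ)∫₀^τ μ[g_{t₀−τ'}, τ'] dτ'` … where the latter denotes
Perelman's `μ`-functional" — the pointwise-in-`τ` input `𝒲 ≥ μ`): if `u > 0` is smooth with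
`∫_M u dV_g = 1` and `τ > 0`, then `f = −log u − (m/2) log(4πτ)` is smooth and compatible, so
`μ(g, τ) ≤ 𝒲(g, f, τ)` by the definition of `μ` as an infimum (`muEntropy_le`).
[cite: Bamler2020Entropy, §5.1, display after Prop. 5.2] [cite: Perelman2002, §3.1, definition of μ] -/
theorem muEntropy_le_wEntropy_of_integral_eq_one
    (g : PseudoRiemannianMetric I ∞ (EuclideanSpace ℝ (Fin m)) (TangentSpace I : M → Type _))
    (cov : CovariantDerivative I (EuclideanSpace ℝ (Fin m)) (TangentSpace I : M → Type _))
    {u : M → ℝ} (hu : ContMDiff I 𝓘(ℝ, ℝ) ∞ u) (hpos : ∀ x, 0 < u x)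
    (hmass : ∫ x, u x ∂g.riemVolume = 1) {τ : ℝ} (hτ : 0 < τ) :
    g.muEntropy cov τ ≤ ((g.wEntropy cov
      (fun x ↦ -Real.log (u x) - (m : ℝ) / 2 * Real.log (4 * Real.pi * τ)) τ : ℝ) : EReal) := by
  refine PseudoRiemannianMetric.muEntropy_le (contMDiff_neg_log_sub hu hpos _) ?_
  rw [PseudoRiemannianMetric.isEntropyCompatible_iff, finrank_euclideanSpace_fin,
    entropyDensity_neg_log m hpos hτ]
  exact hmass

end Static

/-! ### Bamler's Prop. 5.2 along a conjugate heat flow of probability densities -/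

section Flow

variable {m : ℕ} {H : Type v} [TopologicalSpace H]
  {I : ModelWithCorners ℝ (EuclideanSpace ℝ (Fin m)) H} [I.Boundaryless]
  {M : Type w} [TopologicalSpace M] [ChartedSpace H M] [IsManifold I ∞ M]
  [T2Space M] [CompactSpace M] [MeasurableSpace M] [BorelSpace M]
  {g : ℝ → PseudoRiemannianMetric I ∞ (EuclideanSpace ℝ (Fin m)) (TangentSpace I : M → Type _)}
  {cov : ℝ → CovariantDerivative I (EuclideanSpace ℝ (Fin m)) (TangentSpace I : M → Type _)}

omit [I.Boundaryless] [IsManifold I ∞ M] [T2Space M] [CompactSpace M] [MeasurableSpace M]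
  [BorelSpace M] in
/-- The potential `f(t, x) = −log u(t, x) − (n/2) log(4π(τ₀ − t))` of a positive density smooth on
`M × [0, T']` is smooth on `M × [0, T']` when `τ₀ > T'`. [folklore] -/
theorem contMDiffOn_entropyPotential {T' τ₀ : ℝ} (hτ₀ : T' < τ₀) {u : ℝ → M → ℝ}
    (hpos : ∀ t ∈ Icc 0 T', ∀ x, 0 < u t x)
    (hu : ContMDiffOn (I.prod 𝓘(ℝ, ℝ)) 𝓘(ℝ, ℝ) ∞ (fun p : M × ℝ ↦ u p.2 p.1) (univ ×ˢ Icc 0 T'))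
    (n : ℕ) :
    ContMDiffOn (I.prod 𝓘(ℝ, ℝ)) 𝓘(ℝ, ℝ) ∞ (fun p : M × ℝ ↦ entropyPotential u n τ₀ p.2 p.1)
      (univ ×ˢ Icc 0 T') := by
  have hc : ContDiffOn ℝ ∞ (fun t : ℝ ↦ (n : ℝ) / 2 * Real.log (4 * Real.pi * (τ₀ - t)))
      (Icc 0 T') := by
    intro t ht
    have hτ : 0 < τ₀ - t := by linarith [ht.2]
    have hne : 4 * Real.pi * (τ₀ - t) ≠ 0 := (mul_pos (by positivity) hτ).ne'
    have h4 : ContDiffAt ℝ ∞ (fun s : ℝ ↦ Real.log (4 * Real.pi * (τ₀ - s))) t :=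
      (Real.contDiffAt_log.2 hne).comp t (contDiffAt_const.mul (contDiffAt_const.sub contDiffAt_id))
    exact (contDiffAt_const.mul h4).contDiffWithinAt
  exact (contMDiffOn_neg_log_prod hpos hu).sub (contMDiffOn_of_time hc)

/-- **Unit mass propagates along the conjugate heat flow**: if `∫ u(T') dV_{g(T')} = 1` then
`∫ u(t) dV_{g(t)} = 1` for all `t ∈ [0, T']` (`IsRicciFlow.integral_conjugateHeat_eq_Icc`,
Topping 2006, Rem. 8.2.2), so the conjugate heat flow of a probability density is a flow of
probability densities as in Bamler 2020a, §5.1. [cite: Topping2006, §8.2, Rem. 8.2.2] -/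
theorem IsRicciFlow.integral_eq_one_of_isConjugateHeatSolutionOn {T' : ℝ} (hT' : 0 < T')
    (h : IsRicciFlow g cov (Icc 0 T')) (hR : ∀ t ∈ Icc 0 T', (g t).IsRiemannian)
    {u : ℝ → M → ℝ} (hsol : IsConjugateHeatSolutionOn g cov (Icc 0 T') u)
    (h1 : ∫ x, u T' x ∂(g T').riemVolume = 1) {t : ℝ} (ht : t ∈ Icc 0 T') :
    ∫ x, u t x ∂(g t).riemVolume = 1 := by
  rw [h.integral_conjugateHeat_eq_Icc hT' hR hsol.1 hsol.2 ht]
  exact h1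

/-- **The time derivative of the pointed Nash entropy** (Bamler 2020a, Prop. 5.2 and its proof;
in print, in `τ = τ₀ − t`: `d/dτ 𝒩_{x₀,t₀}(τ) = ∫ (|∇f|² + R) dν − n/2τ`, the quantity bounded in
(5.6) by `−n/2τ + R_min ≤ · ≤ 0`). Let `(g, cov)` be a Ricci flow of Riemannian metrics on
`[0, T']`, `T' > 0`, on a closed manifold modelled on `ℝ^m`, `u > 0` a solution of the conjugate
heat equation `□* u = 0` on `M × [0, T']` with `∫ u(t) dV_{g(t)} = 1`, and `τ₀ > T'`. Then at every
`t ∈ [0, T']`, within `[0, T']`,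
`d/dt 𝒩(t) = −∫_M (R + |∇f|²) u dV_{g(t)} + m/(2(τ₀ − t))`, `f = entropyPotential u m τ₀`.
Proof: `d/dt ∫ f u dV = ∫ (∂ₜ(f u) − R f u) dV` (`hasDerivWithinAt_integral_of_contMDiffOn`),
`∂ₜ(f u) = (f − 1)∂ₜu + (m/2τ) u`, `∂ₜu = −Δu + Ru`, `∫ Δu dV = 0` and `∫ f Δu dV = ∫ u|∇f|² dV`.
[cite: Bamler2020Entropy, §5.1, Prop. 5.2] -/
theorem IsRicciFlow.hasDerivWithinAt_pointedNashEntropy {T' : ℝ} (hT' : 0 < T')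
    (h : IsRicciFlow g cov (Icc 0 T')) (hR : ∀ t ∈ Icc 0 T', (g t).IsRiemannian)
    {u : ℝ → M → ℝ} (hpos : ∀ t ∈ Icc 0 T', ∀ x, 0 < u t x)
    (hsol : IsConjugateHeatSolutionOn g cov (Icc 0 T') u)
    (hmass : ∀ t ∈ Icc 0 T', ∫ x, u t x ∂(g t).riemVolume = 1) {τ₀ : ℝ} (hτ₀ : T' < τ₀)
    {t : ℝ} (ht : t ∈ Icc 0 T') :
    HasDerivWithinAt (pointedNashEntropy g u m τ₀)
      (-(∫ x, ((g t).scalarCurvatureWith (cov t) x +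
          (g t).gradSq (entropyPotential u m τ₀ t) x) * u t x ∂(g t).riemVolume) +
        (m : ℝ) / (2 * (τ₀ - t))) (Icc 0 T') t := by
  haveI := (g t).hasLeviCivita
  have hu := hsol.1
  have hpde := hsol.2
  have hU : UniqueDiffOn ℝ (Icc 0 T') := uniqueDiffOn_Icc hT'
  have hτ : 0 < τ₀ - t := by linarith [ht.2]
  -- notation: the potential, the scalar curvature, the Laplacian of `u(t)`, its gradient square
  set f : ℝ → M → ℝ := fun s x ↦ entropyPotential u m τ₀ s x with hf
  set R : M → ℝ := fun x ↦ (g t).scalarCurvatureWith (cov t) x with hRdef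
  set Δu : M → ℝ := fun x ↦ (g t).laplaceBeltrami (u t) x with hΔu
  set G : M → ℝ := fun x ↦ (g t).gradSq (f t) x with hG
  -- joint smoothness of `v = f u` on `M × [0, T']`
  have hfs : ContMDiffOn (I.prod 𝓘(ℝ, ℝ)) 𝓘(ℝ, ℝ) ∞ (fun p : M × ℝ ↦ f p.2 p.1)
      (univ ×ˢ Icc 0 T') := contMDiffOn_entropyPotential hτ₀ hpos hu m
  have hv : ContMDiffOn (I.prod 𝓘(ℝ, ℝ)) 𝓘(ℝ, ℝ) ∞ (fun p : M × ℝ ↦ f p.2 p.1 * u p.2 p.1)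
      (univ ×ˢ Icc 0 T') := hfs.mul hu
  -- `d/dt ∫ f u dV = ∫ (∂ₜ(f u) − R f u) dV`
  have hD := h.hasDerivWithinAt_integral_of_contMDiffOn (convex_Icc 0 T') hR
    (v := fun s x ↦ f s x * u s x) hv ht
  -- the time derivatives of `u`, `f` and `f u` at `(x, t)`
  have hud : ∀ x, HasDerivWithinAt (fun s ↦ u s x) (-Δu x + R x * u t x) (Icc 0 T') t := by
    intro x
    have := hasDerivWithinAt_time_of_contMDiffOn (k := ∞) (by simp) hu x ht
    rwa [hpde t ht x] at this
  have hfd : ∀ x, HasDerivWithinAt (fun s ↦ f s x)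
      (-((-Δu x + R x * u t x) / u t x) -
        (m : ℝ) / 2 * ((4 * Real.pi * (-1)) / (4 * Real.pi * (τ₀ - t)))) (Icc 0 T') t := by
    intro x
    have h1 : HasDerivWithinAt (fun s ↦ -Real.log (u s x)) (-((-Δu x + R x * u t x) / u t x))
        (Icc 0 T') t := ((hud x).log (hpos t ht x).ne').neg
    have h4 : HasDerivWithinAt (fun s ↦ 4 * Real.pi * (τ₀ - s)) (4 * Real.pi * (-1))
        (Icc 0 T') t := ((hasDerivWithinAt_id t _).const_sub τ₀).const_mul _
    have h2 : HasDerivWithinAt (fun s ↦ (m : ℝ) / 2 * Real.log (4 * Real.pi * (τ₀ - s)))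
        ((m : ℝ) / 2 * ((4 * Real.pi * (-1)) / (4 * Real.pi * (τ₀ - t)))) (Icc 0 T') t :=
      (h4.log (mul_pos (by positivity) hτ).ne').const_mul _
    exact h1.sub h2
  have hderiv : ∀ x, derivWithin (fun s ↦ f s x * u s x) (Icc 0 T') t =
      Δu x - R x * u t x + (m : ℝ) / (2 * (τ₀ - t)) * u t x +
        f t x * (-Δu x + R x * u t x) := by
    intro x
    have hux : u t x ≠ 0 := (hpos t ht x).ne'
    have hτne : τ₀ - t ≠ 0 := hτ.ne'
    have hπ : (Real.pi : ℝ) ≠ 0 := Real.pi_ne_zero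
    have hvd : HasDerivWithinAt (fun s ↦ f s x * u s x)
        ((-((-Δu x + R x * u t x) / u t x) -
          (m : ℝ) / 2 * ((4 * Real.pi * (-1)) / (4 * Real.pi * (τ₀ - t)))) * u t x +
          f t x * (-Δu x + R x * u t x)) (Icc 0 T') t := (hfd x).mul (hud x)
    rw [hvd.derivWithin (hU t ht)]
    field_simp
    ring
  -- regularity of the slices at time `t`
  have huts : ContMDiff I 𝓘(ℝ, ℝ) ∞ (u t) := contMDiff_slice_of_contMDiffOn hu ht
  have hut2 : ContMDiff I 𝓘(ℝ, ℝ) 2 (u t) := huts.of_le (by norm_cast)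
  have hfts : ContMDiff I 𝓘(ℝ, ℝ) ∞ (f t) := contMDiff_neg_log_sub huts (hpos t ht) _
  have hft1 : ContMDiff I 𝓘(ℝ, ℝ) 1 (f t) := hfts.of_le (by norm_cast)
  have hRc : Continuous R :=
    (contMDiff_scalarCurvatureWith_holds I M (g t) (cov t) (h.isLeviCivita t ht)).continuous
  have hΔc : Continuous Δu := continuous_dalembertian (g t) hut2
  have hGc : Continuous G := continuous_innerDual_mvfderiv (g t) hft1 hft1
  have huc : Continuous (u t) := huts.continuous
  have hfc : Continuous (f t) := hfts.continuous
  -- the four integrals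
  have iΔ : ∫ x, Δu x ∂(g t).riemVolume = 0 := integral_laplaceBeltrami_eq_zero (hR t ht) hut2
  have ifΔ : ∫ x, f t x * Δu x ∂(g t).riemVolume = ∫ x, G x * u t x ∂(g t).riemVolume := by
    have e := integral_neg_log_mul_laplaceBeltrami_eq (hR t ht) huts (hpos t ht)
      ((m : ℝ) / 2 * Real.log (4 * Real.pi * (τ₀ - t)))
    refine Eq.trans ?_ (e.trans ?_)
    · rfl
    · exact integral_congr_ae (Eventually.of_forall fun x ↦ mul_comm _ _)
  have iu : ∫ x, (m : ℝ) / (2 * (τ₀ - t)) * u t x ∂(g t).riemVolume = (m : ℝ) / (2 * (τ₀ - t)) := by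
    rw [integral_const_mul, hmass t ht, mul_one]
  have iR : Integrable (fun x ↦ R x * u t x) (g t).riemVolume :=
    (g t).integrable_of_continuous (hRc.mul huc)
  have iG : Integrable (fun x ↦ G x * u t x) (g t).riemVolume :=
    (g t).integrable_of_continuous (hGc.mul huc)
  have iRG : ∫ x, (R x + G x) * u t x ∂(g t).riemVolume =
      (∫ x, R x * u t x ∂(g t).riemVolume) + ∫ x, G x * u t x ∂(g t).riemVolume := by
    rw [← integral_add iR iG]
    exact integral_congr_ae (Eventually.of_forall fun x ↦ add_mul _ _ _)
  -- the value of the derivative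
  have hval : ∫ x, (derivWithin (fun s ↦ f s x * u s x) (Icc 0 T') t -
      (g t).scalarCurvatureWith (cov t) x * (f t x * u t x)) ∂(g t).riemVolume =
      -(∫ x, (R x + G x) * u t x ∂(g t).riemVolume) + (m : ℝ) / (2 * (τ₀ - t)) := by
    have hpt : ∀ x, derivWithin (fun s ↦ f s x * u s x) (Icc 0 T') t -
        (g t).scalarCurvatureWith (cov t) x * (f t x * u t x) =
        (Δu x - f t x * Δu x - R x * u t x) + (m : ℝ) / (2 * (τ₀ - t)) * u t x := by
      intro x
      rw [hderiv x]
      simp only [hRdef]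
      ring
    have iA : Integrable (fun x ↦ Δu x - f t x * Δu x - R x * u t x) (g t).riemVolume :=
      (g t).integrable_of_continuous ((hΔc.sub (hfc.mul hΔc)).sub (hRc.mul huc))
    have iB : Integrable (fun x ↦ (m : ℝ) / (2 * (τ₀ - t)) * u t x) (g t).riemVolume :=
      (g t).integrable_of_continuous (continuous_const.mul huc)
    have e1 : ∫ x, (Δu x - f t x * Δu x - R x * u t x) + (m : ℝ) / (2 * (τ₀ - t)) * u t x
        ∂(g t).riemVolume = (∫ x, (Δu x - f t x * Δu x - R x * u t x) ∂(g t).riemVolume) +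
        ∫ x, (m : ℝ) / (2 * (τ₀ - t)) * u t x ∂(g t).riemVolume := integral_add iA iB
    have e2 : ∫ x, (Δu x - f t x * Δu x - R x * u t x) ∂(g t).riemVolume =
        (∫ x, (Δu x - f t x * Δu x) ∂(g t).riemVolume) - ∫ x, R x * u t x ∂(g t).riemVolume :=
      integral_sub ((g t).integrable_of_continuous (hΔc.sub (hfc.mul hΔc)))
        ((g t).integrable_of_continuous (hRc.mul huc))
    have e3 : ∫ x, (Δu x - f t x * Δu x) ∂(g t).riemVolume =
        (∫ x, Δu x ∂(g t).riemVolume) - ∫ x, f t x * Δu x ∂(g t).riemVolume :=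
      integral_sub ((g t).integrable_of_continuous hΔc)
        ((g t).integrable_of_continuous (hfc.mul hΔc))
    rw [integral_congr_ae (Eventually.of_forall hpt), e1, e2, e3, iΔ, ifΔ, iu, iRG]
    ring
  -- conclusion
  have key := (hD.sub_const ((m : ℝ) / 2)).congr_deriv hval
  exact key

/-- **Bamler 2020a, Prop. 5.2, first identity: `d/dτ (τ 𝒩) = 𝒲`.** In the setting of
`hasDerivWithinAt_pointedNashEntropy` (Ricci flow of Riemannian metrics on a closed manifold on
`[0, T']`, positive conjugate heat solution `u` of unit mass, basepoint time `τ₀ > T'`), the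
function `t ↦ (τ₀ − t) 𝒩(t)` has derivative `−𝒲(g(t), f(t), τ₀ − t)` within `[0, T']` at every
`t ∈ [0, T']`, `f = entropyPotential u m τ₀` — in print, with `τ = τ₀ − t`,
`d/dτ (τ 𝒩_{x₀,t₀}(τ)) = 𝒲[g_{t₀−τ}, f_{t₀−τ}, τ]` for the conjugate heat kernel measure; here for
any conjugate heat flow of probability densities. Proof: the product rule with
`hasDerivWithinAt_pointedNashEntropy` and `𝒲 = τ ∫ (R + |∇f|²) u + 𝒩 − m/2`
(`wEntropy_eq_nashEntropy_add`). [cite: Bamler2020Entropy, §5.1, Prop. 5.2] -/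
theorem IsRicciFlow.hasDerivWithinAt_mul_pointedNashEntropy {T' : ℝ} (hT' : 0 < T')
    (h : IsRicciFlow g cov (Icc 0 T')) (hR : ∀ t ∈ Icc 0 T', (g t).IsRiemannian)
    {u : ℝ → M → ℝ} (hpos : ∀ t ∈ Icc 0 T', ∀ x, 0 < u t x)
    (hsol : IsConjugateHeatSolutionOn g cov (Icc 0 T') u)
    (hmass : ∀ t ∈ Icc 0 T', ∫ x, u t x ∂(g t).riemVolume = 1) {τ₀ : ℝ} (hτ₀ : T' < τ₀)
    {t : ℝ} (ht : t ∈ Icc 0 T') :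
    HasDerivWithinAt (fun s ↦ (τ₀ - s) * pointedNashEntropy g u m τ₀ s)
      (-(g t).wEntropy (cov t) (entropyPotential u m τ₀ t) (τ₀ - t)) (Icc 0 T') t := by
  have hlt : t < τ₀ := by linarith [ht.2]
  have hB := h.hasDerivWithinAt_pointedNashEntropy hT' hR hpos hsol hmass hτ₀ ht
  have hlin : HasDerivWithinAt (fun s ↦ τ₀ - s) (-1) (Icc 0 T') t := by
    simpa using (hasDerivWithinAt_id t (Icc 0 T')).const_sub τ₀
  refine (hlin.mul hB).congr_deriv ?_
  -- `𝒲(t) = (τ₀ - t) ∫ (R + |∇f|²) u + 𝒩(t) − m/2`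
  have huts : ContMDiff I 𝓘(ℝ, ℝ) ∞ (u t) := contMDiff_slice_of_contMDiffOn hsol.1 ht
  have hfts : ContMDiff I 𝓘(ℝ, ℝ) ∞ (entropyPotential u m τ₀ t) :=
    contMDiff_neg_log_sub huts (hpos t ht) _
  have hRc : Continuous fun x ↦ (g t).scalarCurvatureWith (cov t) x :=
    (contMDiff_scalarCurvatureWith_holds I M (g t) (cov t) (h.isLeviCivita t ht)).continuous
  have hcomp : (g t).IsEntropyCompatible (entropyPotential u m τ₀ t) (τ₀ - t) := by
    rw [PseudoRiemannianMetric.isEntropyCompatible_iff, finrank_euclideanSpace_fin,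
      entropyDensity_entropyPotential m (hpos t ht) hlt]
    exact hmass t ht
  have hW := wEntropy_eq_nashEntropy_add (g t) (cov t) hRc hfts hcomp
  have hN := pointedNashEntropy_eq_nashEntropy g (u := u) (τ₀ := τ₀) (hpos t ht) hlt
  rw [finrank_euclideanSpace_fin] at hW hN
  rw [entropyDensity_entropyPotential m (hpos t ht) hlt, ← hN] at hW
  rw [hW]
  have hτne : τ₀ - t ≠ 0 := by linarith
  field_simp
  ring

/-- **`𝒲` is non-decreasing along a conjugate heat flow** (Perelman 2002, (3.4); Bamler 2020a,
Prop. 5.2, second identity `d²/dτ²(τ𝒩) = −2τ∫|Ric + ∇²f − g/2τ|² dν ≤ 0`, i.e. `d𝒲/dτ ≤ 0`): in the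
setting above, `t ↦ 𝒲(g(t), f(t), τ₀ − t)` is non-decreasing on `[0, T']` — the tree's Perelman
entropy formula (`IsRicciFlow.conjugateHeatOp_entropyIntegrand_nonpos`,
`monotoneOn_wEntropy_of_conjugateHeatOp_entropyIntegrand_nonpos`) with `τ = τ₀ − T'`.
[cite: Bamler2020Entropy, §5.1, Prop. 5.2] [cite: Perelman2002, §3.1, (3.4)] -/
theorem IsRicciFlow.monotoneOn_wEntropy_entropyPotential {T' : ℝ} (hT' : 0 < T')
    (h : IsRicciFlow g cov (Icc 0 T')) (hR : ∀ t ∈ Icc 0 T', (g t).IsRiemannian)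
    {u : ℝ → M → ℝ} (hpos : ∀ t ∈ Icc 0 T', ∀ x, 0 < u t x)
    (hsol : IsConjugateHeatSolutionOn g cov (Icc 0 T') u) {τ₀ : ℝ} (hτ₀ : T' < τ₀) :
    MonotoneOn (fun t ↦ (g t).wEntropy (cov t) (entropyPotential u m τ₀ t) (τ₀ - t)) (Icc 0 T') := by
  have key := h.monotoneOn_wEntropy_of_conjugateHeatOp_entropyIntegrand_nonpos hT' hR
    (τ := τ₀ - T') (sub_pos.2 hτ₀) hpos hsol.1 (fun t ht x ↦
      h.conjugateHeatOp_entropyIntegrand_nonpos hT' hR hpos hsol finrank_euclideanSpace_fin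
        (τ₀ := τ₀ - T' + T') (by linarith) ht x)
  simp only [sub_add_cancel] at key
  exact key

/-- **`τ 𝒩(τ) = ∫ 𝒲`, finite-interval form** (Bamler 2020a, Prop. 5.2, first identity
integrated; in print `𝒩_{x₀,t₀}(τ) = (1/τ)∫₀^τ 𝒲`): in the setting above, for
`0 ≤ t₁ ≤ t₂ ≤ T'`,
`(τ₀ − t₁) 𝒩(t₁) − (τ₀ − t₂) 𝒩(t₂) = ∫_{t₁}^{t₂} 𝒲(g(s), f(s), τ₀ − s) ds` (fundamental theorem of
calculus for `hasDerivWithinAt_mul_pointedNashEntropy`; `𝒲` is continuous in `s` by Perelman's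
formula `hasDerivWithinAt_wEntropy`). [cite: Bamler2020Entropy, §5.1, Prop. 5.2] -/
theorem IsRicciFlow.mul_pointedNashEntropy_sub_eq_integral {T' : ℝ} (hT' : 0 < T')
    (h : IsRicciFlow g cov (Icc 0 T')) (hR : ∀ t ∈ Icc 0 T', (g t).IsRiemannian)
    {u : ℝ → M → ℝ} (hpos : ∀ t ∈ Icc 0 T', ∀ x, 0 < u t x)
    (hsol : IsConjugateHeatSolutionOn g cov (Icc 0 T') u)
    (hmass : ∀ t ∈ Icc 0 T', ∫ x, u t x ∂(g t).riemVolume = 1) {τ₀ : ℝ} (hτ₀ : T' < τ₀)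
    {t₁ t₂ : ℝ} (ht₁ : t₁ ∈ Icc 0 T') (ht₂ : t₂ ∈ Icc 0 T') (h12 : t₁ ≤ t₂) :
    (τ₀ - t₁) * pointedNashEntropy g u m τ₀ t₁ - (τ₀ - t₂) * pointedNashEntropy g u m τ₀ t₂ =
      ∫ s in t₁..t₂, (g s).wEntropy (cov s) (entropyPotential u m τ₀ s) (τ₀ - s) := by
  set φ : ℝ → ℝ := fun s ↦ (τ₀ - s) * pointedNashEntropy g u m τ₀ s with hφ
  set W : ℝ → ℝ := fun s ↦ (g s).wEntropy (cov s) (entropyPotential u m τ₀ s) (τ₀ - s) with hW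
  have hsub : Icc t₁ t₂ ⊆ Icc 0 T' := Icc_subset_Icc ht₁.1 ht₂.2
  have hderφ : ∀ s ∈ Icc 0 T', HasDerivWithinAt φ (-W s) (Icc 0 T') s := fun s hs ↦
    h.hasDerivWithinAt_mul_pointedNashEntropy hT' hR hpos hsol hmass hτ₀ hs
  have hcontφ : ContinuousOn φ (Icc t₁ t₂) := fun s hs ↦
    (hderφ s (hsub hs)).continuousWithinAt.mono hsub
  have hWcont : ContinuousOn W (Icc t₁ t₂) := by
    intro s hs
    haveI := (g s).hasLeviCivita
    exact (h.hasDerivWithinAt_wEntropy hT' hR hpos hsol hτ₀ (hsub hs)).continuousWithinAt.mono hsub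
  have hint : IntervalIntegrable (fun s ↦ -W s) volume t₁ t₂ := by
    refine (hWcont.neg.mono ?_).intervalIntegrable
    rw [uIcc_of_le h12]
  have hFTC := intervalIntegral.integral_eq_sub_of_hasDeriv_right_of_le h12 hcontφ
    (fun s hs ↦ ((hderφ s (hsub (Ioo_subset_Icc_self hs))).hasDerivAt
      (Icc_mem_nhds (ht₁.1.trans_lt hs.1) (hs.2.trans_le ht₂.2))).hasDerivWithinAt) hint
  rw [intervalIntegral.integral_neg] at hFTC
  show φ t₁ - φ t₂ = ∫ s in t₁..t₂, W s
  linarith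

/-- Continuity of `s ↦ 𝒲(g(s), f(s), τ₀ − s)` on `[0, T']` along a conjugate heat flow (from
Perelman's entropy formula `hasDerivWithinAt_wEntropy`).
[cite: Perelman2002, §3.1, (3.4)] -/
theorem IsRicciFlow.continuousOn_wEntropy_entropyPotential {T' : ℝ} (hT' : 0 < T')
    (h : IsRicciFlow g cov (Icc 0 T')) (hR : ∀ t ∈ Icc 0 T', (g t).IsRiemannian)
    {u : ℝ → M → ℝ} (hpos : ∀ t ∈ Icc 0 T', ∀ x, 0 < u t x)
    (hsol : IsConjugateHeatSolutionOn g cov (Icc 0 T') u) {τ₀ : ℝ} (hτ₀ : T' < τ₀) :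
    ContinuousOn (fun s ↦ (g s).wEntropy (cov s) (entropyPotential u m τ₀ s) (τ₀ - s))
      (Icc 0 T') := by
  intro s hs
  haveI := (g s).hasLeviCivita
  exact (h.hasDerivWithinAt_wEntropy hT' hR hpos hsol hτ₀ hs).continuousWithinAt

/-- **Concavity of `τ 𝒩(τ)`, lower form** (Bamler 2020a, Prop. 5.2: `d/dτ(τ𝒩) = 𝒲` and
`d²/dτ²(τ𝒩) ≤ 0`): for `0 ≤ t₁ ≤ t₂ ≤ T'`,
`(t₂ − t₁) 𝒲(t₁) ≤ (τ₀ − t₁) 𝒩(t₁) − (τ₀ − t₂) 𝒩(t₂)` (`= ∫_{t₁}^{t₂} 𝒲`, and `𝒲` is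
non-decreasing in `t`). [cite: Bamler2020Entropy, §5.1, Prop. 5.2] -/
theorem IsRicciFlow.mul_wEntropy_le_mul_pointedNashEntropy_sub {T' : ℝ} (hT' : 0 < T')
    (h : IsRicciFlow g cov (Icc 0 T')) (hR : ∀ t ∈ Icc 0 T', (g t).IsRiemannian)
    {u : ℝ → M → ℝ} (hpos : ∀ t ∈ Icc 0 T', ∀ x, 0 < u t x)
    (hsol : IsConjugateHeatSolutionOn g cov (Icc 0 T') u)
    (hmass : ∀ t ∈ Icc 0 T', ∫ x, u t x ∂(g t).riemVolume = 1) {τ₀ : ℝ} (hτ₀ : T' < τ₀)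
    {t₁ t₂ : ℝ} (ht₁ : t₁ ∈ Icc 0 T') (ht₂ : t₂ ∈ Icc 0 T') (h12 : t₁ ≤ t₂) :
    (t₂ - t₁) * (g t₁).wEntropy (cov t₁) (entropyPotential u m τ₀ t₁) (τ₀ - t₁) ≤
      (τ₀ - t₁) * pointedNashEntropy g u m τ₀ t₁ - (τ₀ - t₂) * pointedNashEntropy g u m τ₀ t₂ := by
  have hsub : Icc t₁ t₂ ⊆ Icc 0 T' := Icc_subset_Icc ht₁.1 ht₂.2
  have hmono := h.monotoneOn_wEntropy_entropyPotential hT' hR hpos hsol hτ₀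
  have hWc := (h.continuousOn_wEntropy_entropyPotential hT' hR hpos hsol hτ₀).mono hsub
  rw [h.mul_pointedNashEntropy_sub_eq_integral hT' hR hpos hsol hmass hτ₀ ht₁ ht₂ h12]
  have key := intervalIntegral.integral_mono_on (μ := volume) h12 intervalIntegrable_const
    (hWc.mono (by rw [uIcc_of_le h12])).intervalIntegrable
    (fun s hs ↦ hmono ht₁ (hsub hs) hs.1)
  rwa [intervalIntegral.integral_const, smul_eq_mul] at key

/-- **Concavity of `τ 𝒩(τ)`, upper form** (Bamler 2020a, Prop. 5.2): for `0 ≤ t₁ ≤ t₂ ≤ T'`,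
`(τ₀ − t₁) 𝒩(t₁) − (τ₀ − t₂) 𝒩(t₂) ≤ (t₂ − t₁) 𝒲(t₂)`. With `hasDerivWithinAt_mul_pointedNashEntropy`
this is the finite-interval content of "`𝒩 ≥ 𝒲`, `d𝒩/dτ ≤ 0`" of Prop. 5.2, whose printed form
needs the flow up to the basepoint time (`τ𝒩(τ) → 0` as `τ → 0`). [cite: Bamler2020Entropy, §5.1, Prop. 5.2] -/
theorem IsRicciFlow.mul_pointedNashEntropy_sub_le_mul_wEntropy {T' : ℝ} (hT' : 0 < T')
    (h : IsRicciFlow g cov (Icc 0 T')) (hR : ∀ t ∈ Icc 0 T', (g t).IsRiemannian)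
    {u : ℝ → M → ℝ} (hpos : ∀ t ∈ Icc 0 T', ∀ x, 0 < u t x)
    (hsol : IsConjugateHeatSolutionOn g cov (Icc 0 T') u)
    (hmass : ∀ t ∈ Icc 0 T', ∫ x, u t x ∂(g t).riemVolume = 1) {τ₀ : ℝ} (hτ₀ : T' < τ₀)
    {t₁ t₂ : ℝ} (ht₁ : t₁ ∈ Icc 0 T') (ht₂ : t₂ ∈ Icc 0 T') (h12 : t₁ ≤ t₂) :
    (τ₀ - t₁) * pointedNashEntropy g u m τ₀ t₁ - (τ₀ - t₂) * pointedNashEntropy g u m τ₀ t₂ ≤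
      (t₂ - t₁) * (g t₂).wEntropy (cov t₂) (entropyPotential u m τ₀ t₂) (τ₀ - t₂) := by
  have hsub : Icc t₁ t₂ ⊆ Icc 0 T' := Icc_subset_Icc ht₁.1 ht₂.2
  have hmono := h.monotoneOn_wEntropy_entropyPotential hT' hR hpos hsol hτ₀
  have hWc := (h.continuousOn_wEntropy_entropyPotential hT' hR hpos hsol hτ₀).mono hsub
  rw [h.mul_pointedNashEntropy_sub_eq_integral hT' hR hpos hsol hmass hτ₀ ht₁ ht₂ h12]
  have key := intervalIntegral.integral_mono_on (μ := volume) h12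
    (hWc.mono (by rw [uIcc_of_le h12])).intervalIntegrable intervalIntegrable_const
    (fun s hs ↦ hmono (hsub hs) ht₂ hs.2)
  rwa [intervalIntegral.integral_const, smul_eq_mul] at key

/-- **The entropy floor passes to the pointed Nash entropy** (Bamler 2020a, display after
Prop. 5.2: "`𝒩_{x₀,t₀}(τ) ≥ (1/τ)∫₀^τ μ[g_{t₀−τ'}, τ'] dτ'` … So a lower bound on the pointed Nash
entropy is common in Ricci flows with non-degenerate initial data"), finite-interval form: in the
setting above, if Perelman's `μ(g(s), τ₀ − s) ≥ F` for all `s ∈ [t₁, t₂]` (`μ = muEntropy`, an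
infimum over smooth compatible `f`, `PerelmanEntropy.lean`), then
`(τ₀ − t₂) 𝒩(t₂) + (t₂ − t₁) F ≤ (τ₀ − t₁) 𝒩(t₁)`:
`(τ₀ − t₁)𝒩(t₁) − (τ₀ − t₂)𝒩(t₂) = ∫_{t₁}^{t₂} 𝒲 ≥ ∫_{t₁}^{t₂} μ ≥ (t₂ − t₁) F`
(`muEntropy_le_wEntropy_of_integral_eq_one`). For the conjugate heat kernel and `t₂ → τ₀` this is
the printed `𝒩_{x₀,t₀}(τ) ≥ F`. [cite: Bamler2020Entropy, §5.1, display after Prop. 5.2] -/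
theorem IsRicciFlow.mul_pointedNashEntropy_add_mul_le {T' : ℝ} (hT' : 0 < T')
    (h : IsRicciFlow g cov (Icc 0 T')) (hR : ∀ t ∈ Icc 0 T', (g t).IsRiemannian)
    {u : ℝ → M → ℝ} (hpos : ∀ t ∈ Icc 0 T', ∀ x, 0 < u t x)
    (hsol : IsConjugateHeatSolutionOn g cov (Icc 0 T') u)
    (hmass : ∀ t ∈ Icc 0 T', ∫ x, u t x ∂(g t).riemVolume = 1) {τ₀ : ℝ} (hτ₀ : T' < τ₀)
    {t₁ t₂ : ℝ} (ht₁ : t₁ ∈ Icc 0 T') (ht₂ : t₂ ∈ Icc 0 T') (h12 : t₁ ≤ t₂) {F : ℝ}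
    (hF : ∀ s ∈ Icc t₁ t₂, ((F : ℝ) : EReal) ≤ (g s).muEntropy (cov s) (τ₀ - s)) :
    (τ₀ - t₂) * pointedNashEntropy g u m τ₀ t₂ + (t₂ - t₁) * F ≤
      (τ₀ - t₁) * pointedNashEntropy g u m τ₀ t₁ := by
  have hsub : Icc t₁ t₂ ⊆ Icc 0 T' := Icc_subset_Icc ht₁.1 ht₂.2
  have hWc := (h.continuousOn_wEntropy_entropyPotential hT' hR hpos hsol hτ₀).mono hsub
  have hD := h.mul_pointedNashEntropy_sub_eq_integral hT' hR hpos hsol hmass hτ₀ ht₁ ht₂ h12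
  have hWF : ∀ s ∈ Icc t₁ t₂, F ≤ (g s).wEntropy (cov s) (entropyPotential u m τ₀ s) (τ₀ - s) := by
    intro s hs
    have hs' := hsub hs
    have hμ := muEntropy_le_wEntropy_of_integral_eq_one (g s) (cov s)
      (contMDiff_slice_of_contMDiffOn hsol.1 hs') (hpos s hs') (hmass s hs') (τ := τ₀ - s)
      (by linarith [hs'.2])
    exact EReal.coe_le_coe_iff.1 ((hF s hs).trans hμ)
  have key := intervalIntegral.integral_mono_on (μ := volume) h12 intervalIntegrable_const
    (hWc.mono (by rw [uIcc_of_le h12])).intervalIntegrable hWF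
  rw [intervalIntegral.integral_const, smul_eq_mul] at key
  linarith

end Flow

end Literature.Geometry.Riemannian

end
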